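import Summits.AtomisticToContinuum.Crystallization.Theorems.PhononSlackCertificatesCoerciveTwoShellGapBlocks

/-!
# Crux `PhononSlackCertificates.NearFarGlueR` (stmt-AtomisticToContinuum-14970), line `Sketch`:
# the finite `3/10`-separated tight-contact gap implies its torus form (registered sub-goal
# `stub_torusOfSepTight`)

The line's residual ("tight contact gap", instance `δ = 3/10`) asks that every `3/10`-separated
finite configuration `x` of `ℝ³` pay `g₂` per TIGHT CONTACT — a `1/20`-bad particle within `21/20`
of a `1/20`-good one — above `N·e*`, `e* = ⨅_Q e(Q)`.  This file proves that it implies the TORUS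
FORM: every periodic configuration `P` with `3/10`-separated point set pays `g₂` per tight contact
of its motif and per cell, `e* + g₂ · #T(motif)/#motif ≤ e(P)`, where a motif point `y` is a tight
contact of `P` if it is set-bad in `P.points` and some set-good `z ∈ P.points` has
`dist z y ≤ 21/20`.

The proof is the trial-block argument of
`CoerciveTwoShellGapBlocks.torusTwoShellGap_of_sepTwoShellGap` (bad count, separation `1/3`) re-run
for the tight-contact count on the landed block infrastructure `ChargedEnergyGap.Negative.Blocks*`:
the block `x_K = Blocks.blockConfig P K` (`#motif · K³` points `y + Σ kᵢbᵢ`) is `3/10`-separated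
with `P.points` (`block_separated_of_sep`), has energy `≤ #motif·K³·(e(P) + ε)` for `K ≥ K₀(ε)`
(`Blocks.exists_block_energy_le`), and contains at least `#T(motif) · (K³ − 6·L·K²)` tight
contacts, `L = depth P 2 + depth P 2` (`card_tight_block_ge`): for a tight motif point `y` and an
`L`-deep coordinate triple `k` the block index of `(y, k)` is bad in `x_K` (`block_bad_iff`), and
the translate `z + Σ kᵢbᵢ` of the good partner `z` of `y` is set-good (lattice invariance,
`isTwoShellGoodSet_add`), lies within `21/20 < 2` of the block point, hence IS a block point
(`Blocks.exists_eq_toP_of_dist_lt`) with `depth P 2`-deep coordinates (`Blocks.isDeep_of_near`),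
hence is good in `x_K` (`block_good_iff`) — `tight_block_of_deep`.  Feed `x_K` to the finite gap
(`sepTight_block`), divide by `#motif·K³`, let `K → ∞`, `ε → 0` (`stub_torusOfSepTight`).
All `[folklore]`.
-/

noncomputable section

namespace Summit.AtomisticToContinuum.Crystallization.Theorems.PhononSlackCertificatesNearFarGlueR

open scoped BigOperators Classical
open Literature.MathematicalPhysics.StatisticalMechanics Literature.Geometry.DiscreteGeometry
open Summit.AtomisticToContinuum.Crystallization.Theorems.ChargedEnergyGapNegative
open Summit.AtomisticToContinuum.Crystallization.Theorems.CoerciveTwoShellGapBlocks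
  (isTwoShellGoodSet_add block_good_iff block_bad_iff)

/-! ## §1 Deep tight motif cells are tight block indices -/

/-- **A deep tight motif cell is a tight contact of the block.**  Let `u = (y, k)` be a block
index of `x_K = Blocks.blockConfig P K` with `(depth P 2 + depth P 2)`-deep coordinates `k`, whose
motif point `y` is `1/20`-bad in `P.points` and has a `1/20`-good `z ∈ P.points` within `21/20`.
Then the index of `u` is bad in `x_K` (`block_bad_iff`) and has a good index of `x_K` within
`21/20`: the translate of `z` by the period `Σ kᵢbᵢ` is set-good (`isTwoShellGoodSet_add`), is a
block point (`Blocks.exists_eq_toP_of_dist_lt`, `21/20 < 2`) with `depth P 2`-deep coordinates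
(`Blocks.isDeep_of_near`), hence good in `x_K` (`block_good_iff`). [folklore] -/
theorem tight_block_of_deep (P : PeriodicConfiguration 3) (K : ℕ) {u : Blocks.BIdx P K}
    (hk : Blocks.IsDeep K (Blocks.depth P 2 + Blocks.depth P 2) u.2)
    (hbad : ¬ IsTwoShellGoodSet (1 / 20) (47 / 50) 1 P.points (u.1 : EuclideanSpace ℝ (Fin 3)))
    (hz : ∃ z ∈ P.points, IsTwoShellGoodSet (1 / 20) (47 / 50) 1 P.points z ∧
      dist z (u.1 : EuclideanSpace ℝ (Fin 3)) ≤ 21 / 20) :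
    ¬ IsTwoShellGood (1 / 20) (47 / 50) 1 (Blocks.blockConfig P K)
        (Fintype.equivFin (Blocks.BIdx P K) u) ∧
      ∃ i : Fin (Fintype.card (Blocks.BIdx P K)),
        IsTwoShellGood (1 / 20) (47 / 50) 1 (Blocks.blockConfig P K) i ∧
          dist (Blocks.blockConfig P K i)
            (Blocks.blockConfig P K (Fintype.equivFin (Blocks.BIdx P K) u)) ≤ 21 / 20 := by
  have hsymm : ∀ w : Blocks.BIdx P K,
      (Fintype.equivFin (Blocks.BIdx P K)).symm (Fintype.equivFin (Blocks.BIdx P K) w) = w :=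
    fun w => Equiv.symm_apply_apply _ w
  have hx : ∀ w : Blocks.BIdx P K,
      Blocks.blockConfig P K (Fintype.equivFin (Blocks.BIdx P K) w) = Blocks.bpt P K w := fun w => by
    rw [Blocks.blockConfig_apply, hsymm]
  have hdeep : ∀ w : Blocks.BIdx P K, Blocks.IsDeep K (Blocks.depth P 2) w.2 →
      Blocks.IsDeep K (Blocks.depth P 2)
        ((Fintype.equivFin (Blocks.BIdx P K)).symm (Fintype.equivFin (Blocks.BIdx P K) w)).2 :=
    fun w hw => by rw [hsymm]; exact hw
  have hk2 : Blocks.IsDeep K (Blocks.depth P 2) u.2 :=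
    Blocks.IsDeep.mono K (Nat.le_add_right _ _) hk
  refine ⟨?_, ?_⟩
  · have key := block_bad_iff P K (hdeep u hk2)
    rw [hsymm] at key
    exact key.2 hbad
  · obtain ⟨z, hzP, hzgood, hzy⟩ := hz
    have hgL : Blocks.latVec P (Blocks.coords K u.2) ∈ P.lattice := Blocks.latVec_mem P _
    have hbpt : Blocks.bpt P K u =
        (u.1 : EuclideanSpace ℝ (Fin 3)) + Blocks.latVec P (Blocks.coords K u.2) := rfl
    have hz'P : z + Blocks.latVec P (Blocks.coords K u.2) ∈ P.points := P.add_mem_points hzP hgL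
    have hz'good : IsTwoShellGoodSet (1 / 20) (47 / 50) 1 P.points
        (z + Blocks.latVec P (Blocks.coords K u.2)) :=
      isTwoShellGoodSet_add P hgL hzgood
    have hdist : dist (Blocks.bpt P K u) (z + Blocks.latVec P (Blocks.coords K u.2)) ≤ 21 / 20 := by
      rw [hbpt, dist_add_right, dist_comm]; exact hzy
    have hne : (⟨z + Blocks.latVec P (Blocks.coords K u.2), hz'P⟩ : P.points) ≠ Blocks.toP P K u := by
      intro h
      have h' : z + Blocks.latVec P (Blocks.coords K u.2) =
          (u.1 : EuclideanSpace ℝ (Fin 3)) + Blocks.latVec P (Blocks.coords K u.2) := by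
        have := congrArg Subtype.val h
        simpa [hbpt] using this
      have hzy' : z = (u.1 : EuclideanSpace ℝ (Fin 3)) := add_right_cancel h'
      rw [hzy'] at hzgood
      exact hbad hzgood
    obtain ⟨v, -, hv⟩ := Blocks.exists_eq_toP_of_dist_lt P K (u := u) hk2 _ hne
      (lt_of_le_of_lt hdist (by norm_num))
    have hbv : Blocks.bpt P K v = z + Blocks.latVec P (Blocks.coords K u.2) := by
      simpa using congrArg Subtype.val hv
    have hdist2 : dist (Blocks.bpt P K u) (Blocks.bpt P K v) ≤ 2 := by
      rw [hbv]; exact hdist.trans (by norm_num)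
    have hvdeep : Blocks.IsDeep K (Blocks.depth P 2) v.2 :=
      Blocks.isDeep_of_near P K (u := u) (v := v) hk hdist2
    refine ⟨Fintype.equivFin (Blocks.BIdx P K) v, ?_, ?_⟩
    · rw [block_good_iff P K (hdeep v hvdeep), hx, hbv]
      exact hz'good
    · rw [hx, hx, hbv, hbpt, dist_add_right]
      exact hzy

/-- **Counting.**  The block `x_K` has at least `#T(motif) · (K³ − 6·L·K²)` tight contacts,
`L = depth P 2 + depth P 2`: every pair (tight motif point, `L`-deep coordinate triple) gives a
distinct tight block index (`tight_block_of_deep`), and at most `6·L·K²` coordinate triples are not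
`L`-deep (`Blocks.card_not_deep_le`). [folklore] -/
theorem card_tight_block_ge (P : PeriodicConfiguration 3) (K : ℕ) :
    ((P.motif.filter fun y => ¬ IsTwoShellGoodSet (1 / 20) (47 / 50) 1 P.points y ∧
        ∃ z ∈ P.points, IsTwoShellGoodSet (1 / 20) (47 / 50) 1 P.points z ∧
          dist z y ≤ 21 / 20).card : ℝ) *
        ((K : ℝ) ^ 3 - 6 * ((Blocks.depth P 2 + Blocks.depth P 2 : ℕ) : ℝ) * (K : ℝ) ^ 2) ≤
      (Nat.card {j : Fin (Fintype.card (Blocks.BIdx P K)) //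
        ¬ IsTwoShellGood (1 / 20) (47 / 50) 1 (Blocks.blockConfig P K) j ∧
          ∃ i : Fin (Fintype.card (Blocks.BIdx P K)),
            IsTwoShellGood (1 / 20) (47 / 50) 1 (Blocks.blockConfig P K) i ∧
              dist (Blocks.blockConfig P K i) (Blocks.blockConfig P K j) ≤ 21 / 20} : ℝ) := by
  set d : ℕ := Blocks.depth P 2 + Blocks.depth P 2 with hd
  set TM : Finset (EuclideanSpace ℝ (Fin 3)) :=
    P.motif.filter fun y => ¬ IsTwoShellGoodSet (1 / 20) (47 / 50) 1 P.points y ∧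
        ∃ z ∈ P.points, IsTwoShellGoodSet (1 / 20) (47 / 50) 1 P.points z ∧
          dist z y ≤ 21 / 20 with hTM
  set Df : Fin (Fintype.card (Blocks.BIdx P K)) → Prop := fun j =>
    ¬ IsTwoShellGood (1 / 20) (47 / 50) 1 (Blocks.blockConfig P K) j ∧
      ∃ i : Fin (Fintype.card (Blocks.BIdx P K)),
        IsTwoShellGood (1 / 20) (47 / 50) 1 (Blocks.blockConfig P K) i ∧
          dist (Blocks.blockConfig P K i) (Blocks.blockConfig P K j) ≤ 21 / 20 with hDf
  set S : Finset (Fin (Fintype.card (Blocks.BIdx P K))) := Finset.univ.filter fun i => Df i with hS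
  have hcardS : Nat.card {i : Fin (Fintype.card (Blocks.BIdx P K)) // Df i} = S.card := by
    rw [Nat.card_eq_fintype_card, Fintype.card_subtype]
  set Deep : Finset (Fin 3 → Fin K) := Finset.univ.filter fun k => Blocks.IsDeep K d k with hDeep
  -- (1) the injection (tight motif point, deep coordinates) ↦ block index
  have hinj : (TM.attach ×ˢ Deep).card ≤ S.card := by
    refine Finset.card_le_card_of_injOn
      (fun p => Fintype.equivFin (Blocks.BIdx P K) (⟨p.1.1, (Finset.mem_filter.1 p.1.2).1⟩, p.2))
      (fun p hp => ?_) ?_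
    · have hp' := Finset.mem_product.1 hp
      have hk : Blocks.IsDeep K d p.2 := (Finset.mem_filter.1 hp'.2).2
      have hT := (Finset.mem_filter.1 p.1.2).2
      rw [Finset.mem_coe, hS, Finset.mem_filter]
      exact ⟨Finset.mem_univ _,
        tight_block_of_deep P K (u := (⟨p.1.1, (Finset.mem_filter.1 p.1.2).1⟩, p.2)) hk hT.1 hT.2⟩
    · intro p _ q _ hpq
      obtain ⟨h1, h2⟩ := Prod.mk.inj ((Fintype.equivFin (Blocks.BIdx P K)).injective hpq)
      have h11 : p.1.1 = q.1.1 := by simpa using congrArg Subtype.val h1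
      exact Prod.ext (Subtype.ext h11) h2
  -- (2) the number of deep coordinate triples
  have hDeepCard : (K : ℝ) ^ 3 - 6 * (d : ℝ) * (K : ℝ) ^ 2 ≤ (Deep.card : ℝ) := by
    have hsplit := Finset.card_filter_add_card_filter_not
      (s := (Finset.univ : Finset (Fin 3 → Fin K))) (fun k => Blocks.IsDeep K d k)
    have huniv : (Finset.univ : Finset (Fin 3 → Fin K)).card = K ^ 3 := by
      rw [Finset.card_univ, Fintype.card_fun, Fintype.card_fin, Fintype.card_fin]
    have hnot : (Finset.univ.filter fun k : Fin 3 → Fin K => ¬ Blocks.IsDeep K d k).card ≤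
        6 * d * K ^ 2 := by
      convert Blocks.card_not_deep_le K d
    rw [huniv] at hsplit
    have h1 : (Deep.card : ℝ) +
        ((Finset.univ.filter fun k : Fin 3 → Fin K => ¬ Blocks.IsDeep K d k).card : ℝ) =
          (K : ℝ) ^ 3 := by
      rw [hDeep]; exact_mod_cast hsplit
    have h2 : ((Finset.univ.filter fun k : Fin 3 → Fin K => ¬ Blocks.IsDeep K d k).card : ℝ) ≤
        6 * (d : ℝ) * (K : ℝ) ^ 2 := by exact_mod_cast hnot
    linarith
  -- (3) assemble
  have hprod : ((TM.attach ×ˢ Deep).card : ℝ) = (TM.card : ℝ) * (Deep.card : ℝ) := by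
    rw [Finset.card_product, Finset.card_attach, Nat.cast_mul]
  have hD0 : (0 : ℝ) ≤ (TM.card : ℝ) := Nat.cast_nonneg _
  have hinj' : (TM.card : ℝ) * (Deep.card : ℝ) ≤ (S.card : ℝ) := by
    rw [← hprod]; exact_mod_cast hinj
  have hN : (Nat.card {i : Fin (Fintype.card (Blocks.BIdx P K)) // Df i} : ℝ) = (S.card : ℝ) := by
    exact_mod_cast hcardS
  rw [hN]
  exact (mul_le_mul_of_nonneg_left hDeepCard hD0).trans hinj'

/-! ## §2 One block, and the limit `K → ∞` -/

/-- **Blocks of a separated periodic configuration are separated**: if `P.points` is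
`δ`-separated then so is every block `x_K` (its entries are distinct points of `P.points`).
[folklore] -/
theorem block_separated_of_sep (P : PeriodicConfiguration 3) (K : ℕ) (δ : ℝ)
    (hsep : ∀ u ∈ P.points, ∀ v ∈ P.points, u ≠ v → δ ≤ dist u v) :
    ∀ i j : Fin (Fintype.card (Blocks.BIdx P K)), i ≠ j →
      δ ≤ dist (Blocks.blockConfig P K i) (Blocks.blockConfig P K j) := fun _ _ hij =>
  hsep _ (Blocks.bpt_mem P K _) _ (Blocks.bpt_mem P K _) ((Blocks.blockConfig_injective P K).ne hij)

/-- **One block.**  The `3/10`-separated finite tight-contact gap with constant `g` applied to the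
block `x_K` of a periodic `P` with `3/10`-separated point set gives
`#motif · K³ · e* + g · #T(motif) · (K³ − 6 L K²) ≤ E_LJ(x_K)`. [folklore] -/
theorem sepTight_block (P : PeriodicConfiguration 3) (K : ℕ) {g : ℝ} (hg : 0 < g)
    (hG : ∀ (N : ℕ) (x : Fin N → EuclideanSpace ℝ (Fin 3)),
      (∀ i j : Fin N, i ≠ j → (3 / 10 : ℝ) ≤ dist (x i) (x j)) →
      (N : ℝ) * (⨅ Q : PeriodicConfiguration 3, Q.energyPerParticle lennardJones)
        + g * (Nat.card {j : Fin N // ¬ IsTwoShellGood (1 / 20) (47 / 50) 1 x j ∧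
            ∃ i : Fin N, IsTwoShellGood (1 / 20) (47 / 50) 1 x i ∧ dist (x i) (x j) ≤ 21 / 20} : ℝ)
        ≤ interactionEnergy lennardJones x)
    (hsep : ∀ u ∈ P.points, ∀ v ∈ P.points, u ≠ v → (3 / 10 : ℝ) ≤ dist u v) :
    (P.motif.card : ℝ) * (K : ℝ) ^ 3 *
          (⨅ Q : PeriodicConfiguration 3, Q.energyPerParticle lennardJones) +
        g * (((P.motif.filter fun y => ¬ IsTwoShellGoodSet (1 / 20) (47 / 50) 1 P.points y ∧
            ∃ z ∈ P.points, IsTwoShellGoodSet (1 / 20) (47 / 50) 1 P.points z ∧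
              dist z y ≤ 21 / 20).card : ℝ) *
          ((K : ℝ) ^ 3 - 6 * ((Blocks.depth P 2 + Blocks.depth P 2 : ℕ) : ℝ) * (K : ℝ) ^ 2)) ≤
      interactionEnergy lennardJones (Blocks.blockConfig P K) := by
  have h1 := hG _ (Blocks.blockConfig P K) (block_separated_of_sep P K (3 / 10) hsep)
  have hN : ((Fintype.card (Blocks.BIdx P K) : ℕ) : ℝ) = (P.motif.card : ℝ) * (K : ℝ) ^ 3 := by
    rw [Blocks.card_BIdx]; push_cast; ring
  rw [hN] at h1
  have hcount := mul_le_mul_of_nonneg_left (card_tight_block_ge P K) hg.le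
  linarith

/-- **Registered sub-goal `stub_torusOfSepTight`** (line `Sketch`): the finite `3/10`-separated
tight-contact gap implies the tight-contact gap on the torus (same constant): trial blocks of the
periodic configuration carry its tight motif fraction and its energy per particle up to `o(1)`;
see the module docstring. [folklore] -/
theorem stub_torusOfSepTight :
    (∃ g₂ : ℝ, 0 < g₂ ∧ ∀ (N : ℕ) (x : Fin N → EuclideanSpace ℝ (Fin 3)),
      (∀ i j : Fin N, i ≠ j → (3 / 10 : ℝ) ≤ dist (x i) (x j)) →
      (N : ℝ) * (⨅ Q : PeriodicConfiguration 3, Q.energyPerParticle lennardJones)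
        + g₂ * (Nat.card {j : Fin N // ¬ IsTwoShellGood (1 / 20) (47 / 50) 1 x j ∧
            ∃ i : Fin N, IsTwoShellGood (1 / 20) (47 / 50) 1 x i ∧ dist (x i) (x j) ≤ 21 / 20} : ℝ)
        ≤ interactionEnergy lennardJones x) →
    ∃ g : ℝ, 0 < g ∧ ∀ P : PeriodicConfiguration 3,
      (∀ u ∈ P.points, ∀ v ∈ P.points, u ≠ v → (3 / 10 : ℝ) ≤ dist u v) →
      (⨅ Q : PeriodicConfiguration 3, Q.energyPerParticle lennardJones)
        + g * ((P.motif.filter fun y => ¬ IsTwoShellGoodSet (1 / 20) (47 / 50) 1 P.points y ∧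
            ∃ z ∈ P.points, IsTwoShellGoodSet (1 / 20) (47 / 50) 1 P.points z ∧ dist z y ≤ 21 / 20).card : ℝ)
          / (P.motif.card : ℝ)
        ≤ P.energyPerParticle lennardJones := by
  rintro ⟨g, hg, hG⟩
  refine ⟨g, hg, fun P hsep => ?_⟩
  rw [mul_div_assoc]
  set eP : ℝ := (⨅ Q : PeriodicConfiguration 3, Q.energyPerParticle lennardJones) with heP
  set m : ℝ := (P.motif.card : ℝ) with hmdef
  have hm : 0 < m := by rw [hmdef]; exact_mod_cast P.motif_nonempty.card_pos
  set D : ℝ := ((P.motif.filter fun y => ¬ IsTwoShellGoodSet (1 / 20) (47 / 50) 1 P.points y ∧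
      ∃ z ∈ P.points, IsTwoShellGoodSet (1 / 20) (47 / 50) 1 P.points z ∧
        dist z y ≤ 21 / 20).card : ℝ) with hDdef
  have hD0 : 0 ≤ D := Nat.cast_nonneg _
  have hDm : D ≤ m := by
    rw [hDdef, hmdef]
    exact_mod_cast Finset.card_le_card (Finset.filter_subset _ _)
  set d : ℝ := ((Blocks.depth P 2 + Blocks.depth P 2 : ℕ) : ℝ) with hddef
  have hd0 : 0 ≤ d := Nat.cast_nonneg _
  refine le_of_forall_pos_lt_add fun ε hε => ?_
  -- block energy for `K ≥ K₀`, and `K` large enough for the error term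
  obtain ⟨K₀, hK₀, hK⟩ := Blocks.exists_block_energy_le P (show (0 : ℝ) < ε / 4 by positivity)
  obtain ⟨K₁, hK₁⟩ := exists_nat_gt (4 * (6 * d * g) / ε)
  obtain ⟨Kn, hKn0, hKn1⟩ : ∃ Kn : ℕ, K₀ ≤ Kn ∧ K₁ ≤ Kn := ⟨max K₀ K₁, le_max_left _ _, le_max_right _ _⟩
  have hKpos : 0 < Kn := lt_of_lt_of_le hK₀ hKn0
  set k : ℝ := (Kn : ℝ) with hkdef
  have hk : 0 < k := by rw [hkdef]; exact_mod_cast hKpos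
  have hk1 : 4 * (6 * d * g) / ε < k := hK₁.trans_le (by rw [hkdef]; exact_mod_cast hKn1)
  -- the two inequalities on the block `x_Kn`
  have hlow := sepTight_block P Kn hg hG hsep
  have hup := hK Kn hKn0
  have hN : ((Fintype.card (Blocks.BIdx P Kn) : ℕ) : ℝ) = m * k ^ 3 := by
    rw [Blocks.card_BIdx]; push_cast; rw [hmdef, hkdef]
  rw [hN] at hup
  -- combine: m k³ eP + g D (k³ − 6 d k²) ≤ m k³ (e P + ε/4)
  have hcomb : m * k ^ 3 * eP + g * (D * (k ^ 3 - 6 * d * k ^ 2)) ≤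
      m * k ^ 3 * (P.energyPerParticle lennardJones + ε / 4) := hlow.trans hup
  have herr2 : 6 * d * g < k * (ε / 4) := by
    have := (div_lt_iff₀ hε).1 hk1
    linarith
  have hk2 : 0 < k ^ 2 := by positivity
  have hmain : k * (m * eP + g * D) ≤ k * (m * P.energyPerParticle lennardJones + m * (ε / 4)) +
      6 * d * g * D := by
    have : k ^ 2 * (k * (m * eP + g * D)) ≤
        k ^ 2 * (k * (m * P.energyPerParticle lennardJones + m * (ε / 4)) + 6 * d * g * D) := by
      nlinarith
    exact le_of_mul_le_mul_left this hk2
  have hmain2 : k * (m * eP + g * D) < k * (m * P.energyPerParticle lennardJones + m * (ε / 2)) := by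
    have h3 : 6 * d * g * D ≤ m * (6 * d * g) := by
      have := mul_le_mul_of_nonneg_left hDm (by positivity : (0 : ℝ) ≤ 6 * d * g)
      linarith
    have h4 : m * (6 * d * g) < m * (k * (ε / 4)) := mul_lt_mul_of_pos_left herr2 hm
    nlinarith
  have hmain3 : m * eP + g * D < m * P.energyPerParticle lennardJones + m * (ε / 2) :=
    lt_of_mul_lt_mul_left hmain2 hk.le
  have hfin : eP + g * (D / m) < P.energyPerParticle lennardJones + ε / 2 := by
    have h1 : eP + g * (D / m) = (m * eP + g * D) / m := by field_simp
    have h2 : (P.energyPerParticle lennardJones + ε / 2) * m =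
        m * P.energyPerParticle lennardJones + m * (ε / 2) := by ring
    rw [h1, div_lt_iff₀ hm, h2]
    exact hmain3
  linarith

end Summit.AtomisticToContinuum.Crystallization.Theorems.PhononSlackCertificatesNearFarGlueR

end
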